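/-
Origin: expansion seat `planner-pub-hodgecm-pv10-0`, handover v2 2026-08-18 (`HOME/pub-hodgecm-pv10/lean/Pv10/NormOneUnits.lean`, md5 9bca2162, 93 lines);
landed by the gen-6 packager in gate run 22 as `HodgeCM/PerL34/NormOneUnits.lean` (verbatim).
-/
/-
Origin: planner-pub-hodgecm-pv10-0 (unit pub-hodgecm-pv10), HodgeCM publication cell, 2026-08-18.
Node N31g (PerL v5 §4, tex ll. 626–628): "at a non-split finite `v` the group `U(W_i)(L_{0,v}) = L_w^1`
is compact and EQUALS `U(1)(𝓞_v)` (a norm-one element of `L_w` is a unit at the unique place `w` above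
`v`)" — the one-line inference, KERNEL (Mathlib only), with its PRINT input isolated as a hypothesis.
-/
import Mathlib.Analysis.Normed.Field.Basic
import Mathlib.Analysis.Normed.Ring.Lemmas
import Mathlib.Analysis.Normed.Unbundled.SpectralNorm

/-!
# Norm-one elements are units (node N31g, non-split places)

Let `L_w / L_{0,v}` be the quadratic extension of local fields at a non-split place, `σ` its
conjugation.  (1) `norm_map_algEquiv`: `σ` is an ISOMETRY of `L_w` — kernel, from Mathlib's uniqueness
of the extension of a complete nonarchimedean absolute value (`spectralNorm_unique_field_norm_ext`,
`spectralNorm_eq_of_equiv`; in print: Neukirch, *Algebraic Number Theory* II (4.8)).  (2)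
`norm_eq_one_of_mul_conj_eq_one`: if `σ` is an isometry and `x · σ x = 1` then `‖x‖ = 1`, i.e.
`L_w^1 ⊆ 𝓞_w^×`, which is the equality `U(W_i)(L_{0,v}) = L_w^1 = U(1)(𝓞_v)` used to conclude
`χ'_v = 1` at the non-split unramified places; (3) `norm_eq_one_of_mul_algEquiv_eq_one`: (1)+(2),
hypothesis-free.
-/

set_option autoImplicit false

namespace HodgeCM.PerL34.N31g

/-- **PerL l. 627.**  In a normed field with an isometric ring endomorphism `σ` ("conjugation"),
every `x` with `x * σ x = 1` ("norm one") has `‖x‖ = 1` ("is a unit at `w`"). -/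
theorem norm_eq_one_of_mul_conj_eq_one {L : Type*} [NormedField L] (σ : L →+* L)
    (hσ : ∀ x : L, ‖σ x‖ = ‖x‖) (x : L) (hx : x * σ x = 1) : ‖x‖ = 1 := by
  have h : ‖x‖ * ‖x‖ = 1 := by
    calc ‖x‖ * ‖x‖ = ‖x‖ * ‖σ x‖ := by rw [hσ x]
      _ = ‖x * σ x‖ := (norm_mul x (σ x)).symm
      _ = 1 := by rw [hx, norm_one]
  rcases mul_self_eq_one_iff.mp h with h1 | h1
  · exact h1
  · linarith [norm_nonneg x]

/-- Hence the norm-one group sits inside the unit sphere (`L_w^1 ⊆ 𝓞_w^×`), i.e. with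
`U(1)(𝓞_v) := {x : ‖x‖ ≤ 1 ∧ ‖σ x‖ ≤ 1 ∧ x σ x = 1}` one has `L_w^1 = U(1)(𝓞_v)`. -/
theorem normOne_subset_sphere {L : Type*} [NormedField L] (σ : L →+* L)
    (hσ : ∀ x : L, ‖σ x‖ = ‖x‖) :
    {x : L | x * σ x = 1} ⊆ Metric.sphere (0 : L) 1 := fun x hx =>
  mem_sphere_zero_iff_norm.mpr (norm_eq_one_of_mul_conj_eq_one σ hσ x hx)

/-- (Ported verbatim from the HodgeCMPerL package; no docstring in the source.) -/
theorem normOne_eq_integralNormOne {L : Type*} [NormedField L] (σ : L →+* L)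
    (hσ : ∀ x : L, ‖σ x‖ = ‖x‖) :
    {x : L | x * σ x = 1} = {x : L | ‖x‖ ≤ 1 ∧ ‖σ x‖ ≤ 1 ∧ x * σ x = 1} := by
  ext x
  simp only [Set.mem_setOf_eq]
  constructor
  · intro hx
    have h1 := norm_eq_one_of_mul_conj_eq_one σ hσ x hx
    exact ⟨h1.le, by rw [hσ x]; exact h1.le, hx⟩
  · exact fun h => h.2.2

/-! ## The conjugation is an isometry (uniqueness of the extended absolute value) -/

section Isometry

variable {K L : Type*} [NontriviallyNormedField K] [CompleteSpace K] [IsUltrametricDist K]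
  [NormedField L] [NormedAlgebra K L] [Algebra.IsAlgebraic K L]

/-- The norm of a normed field as an absolute value. -/
noncomputable def normAbsoluteValue (L : Type*) [NormedField L] : AbsoluteValue L ℝ where
  toFun := fun x => ‖x‖
  map_mul' := norm_mul
  nonneg' := norm_nonneg
  eq_zero' := fun _ => norm_eq_zero
  add_le' := norm_add_le

/-- (Ported verbatim from the HodgeCMPerL package; no docstring in the source.) -/
@[simp] theorem normAbsoluteValue_apply (L : Type*) [NormedField L] (x : L) :
    normAbsoluteValue L x = ‖x‖ := rfl

/-- **Uniqueness of the extension ⇒ automorphisms are isometries.**  Over a complete nonarchimedean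
`K`, every `K`-algebra automorphism of an algebraic normed field extension `L` preserves the norm. -/
theorem norm_map_algEquiv (σ : L ≃ₐ[K] L) (x : L) : ‖σ x‖ = ‖x‖ := by
  have hext : ∀ k : K, normAbsoluteValue L (algebraMap K L k) = ‖k‖ := fun k => by
    rw [normAbsoluteValue_apply, norm_algebraMap']
  rw [← normAbsoluteValue_apply L (σ x), ← normAbsoluteValue_apply L x,
    spectralNorm_unique_field_norm_ext hext, spectralNorm_unique_field_norm_ext hext,
    ← spectralNorm_eq_of_equiv]

/-- **PerL l. 627, hypothesis-free form.**  `x · σ x = 1` for a `K`-automorphism `σ` of `L`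
(complete nonarchimedean `K`, `L/K` algebraic) forces `‖x‖ = 1`. -/
theorem norm_eq_one_of_mul_algEquiv_eq_one (σ : L ≃ₐ[K] L) (x : L) (hx : x * σ x = 1) :
    ‖x‖ = 1 :=
  norm_eq_one_of_mul_conj_eq_one (σ : L →+* L) (norm_map_algEquiv σ) x hx

end Isometry

end HodgeCM.PerL34.N31g
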